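import Summits.AtomisticToContinuum.HydrodynamicLimit.Theses.JParityClosure
import Literature.Analysis.FluidPDE.TorusPairReflection
import Literature.Analysis.FluidPDE.HardSpherePhaseSpaceProofs
import Literature.MathematicalPhysics.KineticTheory.HardSphereCampbellAssembly
import Literature.MathematicalPhysics.KineticTheory.HardSphereEulerProofs
import Literature.MathematicalPhysics.KineticTheory.MetropolisOddStatistic
import Literature.MathematicalPhysics.KineticTheory.CollisionTubeWeightOscillation
import Summits.AtomisticToContinuum.HydrodynamicLimit.Theorems.JParityClosureOddContactSymmetrySlabCentringOfTools
import Summits.AtomisticToContinuum.HydrodynamicLimit.Theorems.JParityClosureOddContactSymmetryGibbsInvariance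
import HarnessLib

/-!
# The static slab centring S1a from the flux-parity bound G1 and the Maxwell-defect bound P4
# (line `KineticSlabSketch`, registered stub `stub_slabCentring_of`, piece G2)

Crux `JParityClosure.OddContactSymmetry` (stmt-AtomisticToContinuum-17722, rev 5), line `KineticSlabSketch`, lead
`prover-line-stmt-AtomisticToContinuum-17722-c2-0` (cycle 3: S1a reshaped into P3 + G1 + P4 + G2).  This file proves the
registered assembly stub G2 `stub_slabCentring_of : G1 → P4 → S1a`: under the flow-invariant homogeneous Gibbs law
`G_N = localGibbsLaw σ 1 0 θe N (Φ N)` the mean of the Metropolis-odd slab sum over one kinetic slab `(0, ℓ]`,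
`K t_N/2 ≤ ℓ ≤ K t_N` (`t_N = (N+1)^{-1/3}`), read at the kinetic mesoscale `r_K = K^{1/4} t_N`, is `≤ y K (N+1)` for every
`y > 0`, `K ≥ K₀(y)`, `N ≥ N₀(K)`, uniformly over the time shifts `χ(· + s, ·)`, `s ∈ [0, τ]`.

Bookkeeping only; the fixed-`N` statics is `slab_mean_core` (`…SlabCentringOfTools.lean`): `|E X| ≤ |E X₀| + E|X − X₀|`
with `X₀` the slab sum of the weight frozen at the slab start (time-freezing `abs_metroOddSum_sub_le`, p146817), signed
Campbell `E X₀ = ℓ (flux(ρ_G m₀⁺) − flux(ρ_G m₀⁻))` (`integral_collisionPairSum_localGibbsLaw_const`, p145665) bounded through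
G1 + P4, and counting `ℓ flux(ρ_G) = E#terms ≤ 48 v₁ σ² E‖v‖ K (N+1)` (`lintegral_collisionPairSum_le_of_le`, p146757).  Here:
the moduli `ϖ_χ(2ε), ω_χ(K t_N) → 0` by uniform continuity of `χ` on `[0, τ+1] × 𝕋³` (`chi_moduli`), the cutoff `g` is
replaced by the bounded `g ∘ (· ⊔ 0)` which the mark cannot see (`metroOddSum_g_max`, `σ³ρ_r ≥ 0`), and the scales are
`ε² ℓ (N+1) N ≤ σ² K (N+1)` (`count_arith`).
-/

noncomputable section

open scoped BigOperators Classical InnerProductSpace ENNReal Topology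
open Set MeasureTheory Filter
open Literature.Analysis.FluidPDE Literature.MathematicalPhysics.KineticTheory

namespace Summit.AtomisticToContinuum.HydrodynamicLimit.Theorems.OddContactSymmetryKineticSlab

/-! ## Small inputs -/

/-- The mark cannot distinguish `g` from `g ∘ (· ⊔ 0)`: it evaluates `g` only at `σ³ ρ_r(xᵢ) ≥ 0` (`σ ≥ 0`, `r > 0`).
[folklore] -/
theorem metroOddMark_g_max {σ : ℝ} (hσ : 0 ≤ σ) {N : ℕ} (χ : ℝ × UnitAddTorus (Fin 3) → ℝ) (g : ℝ → ℝ)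
    (Ψ : V3 × V3 × V3 → ℝ) {r : ℝ} (hr : 0 < r) (ϑ s : ℝ) (z : Config (N + 1) (Fin 3) T3) (i j : Fin (N + 1)) :
    metroOddMark σ N χ (fun a => g (max a 0)) Ψ r ϑ s z i j = metroOddMark σ N χ g Ψ r ϑ s z i j := by
  dsimp only [metroOddMark]
  rw [max_eq_left (mul_nonneg (pow_nonneg hσ 3) (integral_nonneg fun q => (coneKernel_nonneg_le hr _ _).1))]

/-- The slab sum cannot distinguish `g` from `g ∘ (· ⊔ 0)`. [folklore] -/
theorem metroOddSum_g_max {σ : ℝ} (hσ : 0 ≤ σ) {N : ℕ}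
    (Φ : HardSphereFlow (Torus.geometry (Fin 3)) (hsDiameter σ N) (N + 1)) (S : Set ℝ)
    (χ : ℝ × UnitAddTorus (Fin 3) → ℝ) (g : ℝ → ℝ) (Ψ : V3 × V3 × V3 → ℝ) {r : ℝ} (hr : 0 < r) (ϑ : ℝ)
    (z : Config (N + 1) (Fin 3) T3) :
    metroOddSum σ N Φ S χ (fun a => g (max a 0)) Ψ r ϑ z = metroOddSum σ N Φ S χ g Ψ r ϑ z := by
  unfold metroOddSum
  simp only [metroOddMark_g_max hσ χ g Ψ hr]

/-- Moduli of continuity of the weight `χ` on `[0, τ + 1] × 𝕋³` in time (shifts `t ≤ δ ≤ 1`) and in space (minimal-image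
distance `≤ δ`), uniformly over the slab starts `s ∈ [0, τ]` (the source of `ϖ_χ(2ε), ω_χ(K t_N) → 0`; registered helper of
this file). [folklore] -/
theorem chi_moduli :
    ∀ {χ : ℝ × UnitAddTorus (Fin 3) → ℝ} (_hχ : Continuous χ) (τ : ℝ) {e : ℝ} (_he : 0 < e),
    ∃ δ : ℝ, 0 < δ ∧ δ ≤ 1 ∧
      (∀ s ∈ Set.Icc (0 : ℝ) τ, ∀ t ∈ Set.Icc (0 : ℝ) δ, ∀ x, |χ (t + s, x) - χ (s, x)| ≤ e) ∧
      (∀ s ∈ Set.Icc (0 : ℝ) τ, ∀ x y : UnitAddTorus (Fin 3), Torus.euclidDist x y ≤ δ →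
        |χ (s, x) - χ (s, y)| ≤ e) := by
  intro χ hχ τ e he
  have hK : IsCompact (Icc (0 : ℝ) (τ + 1) ×ˢ (univ : Set (UnitAddTorus (Fin 3)))) :=
    isCompact_Icc.prod isCompact_univ
  have hUC := Metric.uniformContinuousOn_iff.1 (hK.uniformContinuousOn_of_continuous hχ.continuousOn)
  obtain ⟨δ₀, hδ₀, hU⟩ := hUC e he
  refine ⟨min (δ₀ / 2) 1, by positivity, min_le_right _ _, ?_, ?_⟩
  · intro s hs t ht x
    have hts : t + s ∈ Icc (0 : ℝ) (τ + 1) :=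
      ⟨by linarith [hs.1, ht.1], by linarith [hs.2, ht.2, min_le_right (δ₀ / 2) (1 : ℝ)]⟩
    have hs' : s ∈ Icc (0 : ℝ) (τ + 1) := ⟨hs.1, by linarith [hs.2]⟩
    have hd : dist (t + s, x) (s, x) < δ₀ := by
      rw [Prod.dist_eq, dist_self, Real.dist_eq, add_sub_cancel_right, abs_of_nonneg ht.1]
      have : t < δ₀ := by linarith [ht.2, min_le_left (δ₀ / 2) (1 : ℝ)]
      exact max_lt this hδ₀
    have h := hU (t + s, x) ⟨hts, mem_univ _⟩ (s, x) ⟨hs', mem_univ _⟩ hd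
    rw [Real.dist_eq] at h
    exact h.le
  · intro s hs x y hxy
    have hs' : s ∈ Icc (0 : ℝ) (τ + 1) := ⟨hs.1, by linarith [hs.2]⟩
    have hd : dist (s, x) (s, y) < δ₀ := by
      rw [Prod.dist_eq, dist_self]
      refine max_lt hδ₀ ?_
      calc dist x y ≤ Torus.euclidDist x y := by
            rw [dist_eq_norm]; exact Torus.norm_sub_le_euclidDist_holds x y
        _ ≤ min (δ₀ / 2) 1 := hxy
        _ < δ₀ := by linarith [min_le_left (δ₀ / 2) (1 : ℝ)]
    have h := hU (s, x) ⟨hs', mem_univ _⟩ (s, y) ⟨hs', mem_univ _⟩ hd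
    rw [Real.dist_eq] at h
    exact h.le

/-- `K t_N ≤ δ` and `c t_N ≤ δ` eventually in `N` (`t_N = (N+1)^{-1/3} → 0`). [folklore] -/
theorem eventually_scale_le (K : ℕ) (c : ℝ) {δ : ℝ} (hδ : 0 < δ) :
    ∃ N₁ : ℕ, ∀ N : ℕ, N₁ ≤ N →
      (K : ℝ) * ((N + 1 : ℕ) : ℝ) ^ (-(1 / 3 : ℝ)) ≤ δ ∧ c * ((N + 1 : ℕ) : ℝ) ^ (-(1 / 3 : ℝ)) ≤ δ := by
  have h1 : Tendsto (fun N : ℕ => ((N + 1 : ℕ) : ℝ)) atTop atTop :=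
    tendsto_natCast_atTop_atTop.comp (tendsto_add_atTop_nat 1)
  have h2 : Tendsto (fun N : ℕ => ((N + 1 : ℕ) : ℝ) ^ (-(1 / 3 : ℝ))) atTop (𝓝 0) :=
    (tendsto_rpow_neg_atTop (by norm_num : (0 : ℝ) < 1 / 3)).comp h1
  have h3 : Tendsto (fun N : ℕ => (K : ℝ) * ((N + 1 : ℕ) : ℝ) ^ (-(1 / 3 : ℝ))) atTop (𝓝 0) := by
    simpa using h2.const_mul (K : ℝ)
  have h4 : Tendsto (fun N : ℕ => c * ((N + 1 : ℕ) : ℝ) ^ (-(1 / 3 : ℝ))) atTop (𝓝 0) := by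
    simpa using h2.const_mul c
  obtain ⟨N₁, hN₁⟩ := eventually_atTop.1
    ((h3.eventually (Iic_mem_nhds hδ)).and (h4.eventually (Iic_mem_nhds hδ)))
  exact ⟨N₁, fun N hN => hN₁ N hN⟩

/-- `t_N³ (N + 1) = 1`. [folklore] -/
theorem tN_cube_mul (N : ℕ) : (((N + 1 : ℕ) : ℝ) ^ (-(1 / 3 : ℝ))) ^ 3 * ((N : ℝ) + 1) = 1 := by
  have hb : (0 : ℝ) < ((N + 1 : ℕ) : ℝ) := by positivity
  rw [← Real.rpow_natCast, ← Real.rpow_mul hb.le]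
  norm_num
  rw [Real.rpow_neg_one]
  exact inv_mul_cancel₀ (by positivity)

/-- The counting bound at the kinetic scale: `2 · 12 v₁ ε² (N+1) N · 2E · ℓ ≤ 48 v₁ σ² E · K (N+1)` for `ℓ ≤ K t_N`
(`ε = σ t_N`, `t_N³ (N+1) = 1`). [folklore] -/
theorem count_arith {σ Ev : ℝ} (hEv : 0 ≤ Ev) (K N : ℕ) {ℓ : ℝ}
    (hℓ : ℓ ≤ (K : ℝ) * ((N + 1 : ℕ) : ℝ) ^ (-(1 / 3 : ℝ))) :
    2 * (12 * v₁ * hsDiameter σ N ^ 2 * ((N + 1 : ℝ) * N) * (2 * Ev) * ℓ) ≤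
      48 * v₁ * σ ^ 2 * Ev * K * ((N : ℝ) + 1) := by
  set t : ℝ := ((N + 1 : ℕ) : ℝ) ^ (-(1 / 3 : ℝ)) with ht
  have ht0 : 0 < t := Real.rpow_pos_of_pos (by positivity) _
  have hε : hsDiameter σ N = σ * t := rfl
  have hcube : t ^ 3 * ((N : ℝ) + 1) = 1 := tN_cube_mul N
  have hv : 0 < v₁ := v₁_pos
  have hN : (0 : ℝ) ≤ N := N.cast_nonneg
  have key : t ^ 2 * (((N : ℝ) + 1) * N) * ℓ ≤ (K : ℝ) * ((N : ℝ) + 1) := by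
    calc t ^ 2 * (((N : ℝ) + 1) * N) * ℓ ≤ t ^ 2 * (((N : ℝ) + 1) * N) * ((K : ℝ) * t) :=
          mul_le_mul_of_nonneg_left hℓ (by positivity)
      _ = (K : ℝ) * N * (t ^ 3 * ((N : ℝ) + 1)) := by ring
      _ = (K : ℝ) * N := by rw [hcube, mul_one]
      _ ≤ (K : ℝ) * ((N : ℝ) + 1) := mul_le_mul_of_nonneg_left (by linarith) K.cast_nonneg
  rw [hε]
  calc 2 * (12 * v₁ * (σ * t) ^ 2 * (((N : ℝ) + 1) * N) * (2 * Ev) * ℓ)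
      = 48 * v₁ * σ ^ 2 * Ev * (t ^ 2 * (((N : ℝ) + 1) * N) * ℓ) := by ring
    _ ≤ 48 * v₁ * σ ^ 2 * Ev * ((K : ℝ) * ((N : ℝ) + 1)) :=
        mul_le_mul_of_nonneg_left key (by positivity)
    _ = 48 * v₁ * σ ^ 2 * Ev * K * ((N : ℝ) + 1) := by ring

/-- `x/(x+1) ≤ 1`-type step: `A · (y / (3 (A + 1))) ≤ y/3` for `A, y ≥ 0`. [folklore] -/
theorem mul_div_three_le {A y : ℝ} (hA : 0 ≤ A) (hy : 0 ≤ y) : A * (y / (3 * (A + 1))) ≤ y / 3 := by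
  have h1 : A * (y / (3 * (A + 1))) = (y / 3) * (A / (A + 1)) := by
    field_simp
  rw [h1]
  exact mul_le_of_le_one_right (by positivity) ((div_le_one (by positivity)).2 (by linarith))

/-- The final arithmetic of G2: with `M = C_g C_Ψ F`, `e = y/(3(M+1))`, `y′ = y/(3(C_χ M+1))` and the counting bound
`B ≤ F K N₁`, `(½(C_gC_Ψ e + 2C_χC_gC_Ψ y′) + e C_gC_Ψ) B ≤ (5/6) y K N₁ ≤ y K N₁`. [folklore] -/
theorem final_arith {y M Cχ Cg CΨ e y' B F K N₁ : ℝ} (hy : 0 ≤ y) (hM : 0 ≤ M) (hCχ : 0 ≤ Cχ) (hCg : 0 ≤ Cg)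
    (hCΨ : 0 ≤ CΨ) (he : 0 ≤ e) (hy' : 0 ≤ y') (hKN : 0 ≤ K * N₁)
    (hMd : M = Cg * CΨ * F) (hed : e = y / (3 * (M + 1))) (hy'd : y' = y / (3 * (Cχ * M + 1)))
    (hB : B ≤ F * K * N₁) :
    ((Cg * CΨ * e + 2 * Cχ * Cg * CΨ * y') / 2 + e * Cg * CΨ) * B ≤ y * K * N₁ := by
  have hMe : M * e ≤ y / 3 := hed ▸ mul_div_three_le hM hy
  have hCMy : Cχ * M * y' ≤ y / 3 := hy'd ▸ mul_div_three_le (mul_nonneg hCχ hM) hy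
  have hc0 : 0 ≤ (Cg * CΨ * e + 2 * Cχ * Cg * CΨ * y') / 2 + e * Cg * CΨ := by positivity
  have hyKN : 0 ≤ y * (K * N₁) := mul_nonneg hy hKN
  calc ((Cg * CΨ * e + 2 * Cχ * Cg * CΨ * y') / 2 + e * Cg * CΨ) * B
      ≤ ((Cg * CΨ * e + 2 * Cχ * Cg * CΨ * y') / 2 + e * Cg * CΨ) * (F * K * N₁) :=
        mul_le_mul_of_nonneg_left hB hc0
    _ = (3 / 2 * (M * e) + Cχ * M * y') * (K * N₁) := by rw [hMd]; ring
    _ ≤ (3 / 2 * (y / 3) + y / 3) * (K * N₁) := by gcongr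
    _ = 5 / 6 * (y * (K * N₁)) := by ring
    _ ≤ y * (K * N₁) := by linarith
    _ = y * K * N₁ := by ring

/-! ## The registered stub -/

/-- **G2 `stub_slabCentring_of` — the static slab centring S1a from G1 (flux parity of the Metropolis-odd mark,
`stub_fluxOddBound`) and P4 (vanishing relative flux of the Metropolis defect, `stub_maxwellDefectFlux`)**: under the
flow-invariant homogeneous Gibbs law `G_N`, the mean of the Metropolis-odd slab sum over `(0, ℓ]`, `K t_N/2 ≤ ℓ ≤ K t_N`, read
at `r_K = K^{1/4} t_N`, is `≤ y K (N+1)` for every `y > 0`, `K ≥ K₀`, `N ≥ N₀(K)`, uniformly in the slab start `s ∈ [0, τ]`.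
Given `θe`: `σ₀ = min(σ₀^{P4}, 1/4, 1/(2v₁))`; given the data: `C_χ = sup_{[0,τ+1]×𝕋³}|χ|`, `C_g = sup|g ∘ (· ⊔ 0)|`,
`M = C_gC_Ψ · 48v₁σ²E‖v‖`, `y′ = y/(3(C_χM + 1))` for P4 (giving `K₀`), `e = y/(3(M + 1))` for the moduli of `χ` (giving
`δ`, then `N₀(K)` with `K t_N, 2σ t_N ≤ δ`); then `slab_mean_core` at `χ₁ = χ(· + s, ·)`, `χ₀ = χ(s, ·)` and `count_arith`.
[folklore] -/
theorem stub_slabCentring_of :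
    (∀ {σ : ℝ} (_hσ : 0 < σ) (_hσ4 : σ < 1 / 4) {θ : ℝ} (_hθ : 0 < θ) (N : ℕ)
    {χ : ℝ × UnitAddTorus (Fin 3) → ℝ} {g : ℝ → ℝ} {Ψ : V3 × V3 × V3 → ℝ} {r ϑ ϖ Cχ Cg CΨ : ℝ}
    (_hχc : Continuous χ) (_hgc : Continuous g) (_hΨc : Continuous Ψ) (_hr : 0 < r) (_hϑ : 0 < ϑ)
    (_hχ : ∀ p, |χ p| ≤ Cχ) (_hg : ∀ a, |g a| ≤ Cg) (_hΨ : ∀ q, |Ψ q| ≤ CΨ) (_hϖ : 0 ≤ ϖ)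
    (_hmod : ∀ x y : UnitAddTorus (Fin 3), Torus.euclidDist x y ≤ 2 * hsDiameter σ N → |χ (0, x) - χ (0, y)| ≤ ϖ)
    (_hΨodd : ∀ (n v w : V3), ‖n‖ = 1 → Ψ (-n, (reflectVel n (v, w)).1, (reflectVel n (v, w)).2) = -Ψ (n, v, w)),
    2 * outgoingCollisionFlux (hsDiameter σ N) (N + 1)
          (fun w i j => ENNReal.ofReal (canonicalDensity (Torus.geometry (Fin 3)) (hsDiameter σ N) (N + 1)
              (localGibbsProfile (fun _ => 1) (fun _ => 0) (fun _ => θ)) w) *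
            ENNReal.ofReal (metroOddMark σ N χ g Ψ r ϑ 0 w i j)) ≤
        2 * outgoingCollisionFlux (hsDiameter σ N) (N + 1)
          (fun w i j => ENNReal.ofReal (canonicalDensity (Torus.geometry (Fin 3)) (hsDiameter σ N) (N + 1)
              (localGibbsProfile (fun _ => 1) (fun _ => 0) (fun _ => θ)) w) *
            ENNReal.ofReal (-metroOddMark σ N χ g Ψ r ϑ 0 w i j)) +
        (ENNReal.ofReal (Cg * CΨ * ϖ) * outgoingCollisionFlux (hsDiameter σ N) (N + 1)
          (fun w _ _ => ENNReal.ofReal (canonicalDensity (Torus.geometry (Fin 3)) (hsDiameter σ N) (N + 1)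
              (localGibbsProfile (fun _ => 1) (fun _ => 0) (fun _ => θ)) w)) +
         ENNReal.ofReal (2 * Cχ * Cg * CΨ) * outgoingCollisionFlux (hsDiameter σ N) (N + 1)
          (fun w i j => ENNReal.ofReal (canonicalDensity (Torus.geometry (Fin 3)) (hsDiameter σ N) (N + 1)
              (localGibbsProfile (fun _ => 1) (fun _ => 0) (fun _ => θ)) w) *
            ENNReal.ofReal (1 - metroOddMark σ N (fun _ => 1) (fun _ => 1) (fun _ => 1) r ϑ 0 w i j))) ∧
    2 * outgoingCollisionFlux (hsDiameter σ N) (N + 1)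
          (fun w i j => ENNReal.ofReal (canonicalDensity (Torus.geometry (Fin 3)) (hsDiameter σ N) (N + 1)
              (localGibbsProfile (fun _ => 1) (fun _ => 0) (fun _ => θ)) w) *
            ENNReal.ofReal (-metroOddMark σ N χ g Ψ r ϑ 0 w i j)) ≤
        2 * outgoingCollisionFlux (hsDiameter σ N) (N + 1)
          (fun w i j => ENNReal.ofReal (canonicalDensity (Torus.geometry (Fin 3)) (hsDiameter σ N) (N + 1)
              (localGibbsProfile (fun _ => 1) (fun _ => 0) (fun _ => θ)) w) *
            ENNReal.ofReal (metroOddMark σ N χ g Ψ r ϑ 0 w i j)) +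
        (ENNReal.ofReal (Cg * CΨ * ϖ) * outgoingCollisionFlux (hsDiameter σ N) (N + 1)
          (fun w _ _ => ENNReal.ofReal (canonicalDensity (Torus.geometry (Fin 3)) (hsDiameter σ N) (N + 1)
              (localGibbsProfile (fun _ => 1) (fun _ => 0) (fun _ => θ)) w)) +
         ENNReal.ofReal (2 * Cχ * Cg * CΨ) * outgoingCollisionFlux (hsDiameter σ N) (N + 1)
          (fun w i j => ENNReal.ofReal (canonicalDensity (Torus.geometry (Fin 3)) (hsDiameter σ N) (N + 1)
              (localGibbsProfile (fun _ => 1) (fun _ => 0) (fun _ => θ)) w) *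
            ENNReal.ofReal (1 - metroOddMark σ N (fun _ => 1) (fun _ => 1) (fun _ => 1) r ϑ 0 w i j)))) →
    (∀ θe : ℝ, 0 < θe → ∃ σ₀ : ℝ, 0 < σ₀ ∧ ∀ σ : ℝ, 0 < σ → σ < σ₀ → ∀ ϑ : ℝ, 0 < ϑ → ∀ y : ℝ, 0 < y →
    ∃ K₀ : ℕ, ∀ K : ℕ, K₀ ≤ K → ∃ N₀ : ℕ, ∀ N : ℕ, N₀ ≤ N →
      outgoingCollisionFlux (hsDiameter σ N) (N + 1)
          (fun w i j => ENNReal.ofReal (canonicalDensity (Torus.geometry (Fin 3)) (hsDiameter σ N) (N + 1)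
              (localGibbsProfile (fun _ => 1) (fun _ => 0) (fun _ => θe)) w) *
            ENNReal.ofReal (1 - metroOddMark σ N (fun _ => 1) (fun _ => 1) (fun _ => 1)
              ((K : ℝ) ^ (1 / 4 : ℝ) * ((N + 1 : ℕ) : ℝ) ^ (-(1 / 3 : ℝ))) ϑ 0 w i j)) ≤
        ENNReal.ofReal y * outgoingCollisionFlux (hsDiameter σ N) (N + 1)
          (fun w _ _ => ENNReal.ofReal (canonicalDensity (Torus.geometry (Fin 3)) (hsDiameter σ N) (N + 1)
              (localGibbsProfile (fun _ => 1) (fun _ => 0) (fun _ => θe)) w))) →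
    ∃ η₀ : ℝ, 0 < η₀ ∧ ∀ θe : ℝ, 0 < θe → ∃ σ₀ : ℝ, 0 < σ₀ ∧ ∀ σ : ℝ, 0 < σ → σ < σ₀ →
    ∀ Φ : (N : ℕ) → HardSphereFlow (Torus.geometry (Fin 3)) (hsDiameter σ N) (N + 1),
    ∀ τ : ℝ, 0 < τ → ∀ χ : ℝ × UnitAddTorus (Fin 3) → ℝ, Continuous χ →
    ∀ g : ℝ → ℝ, Continuous g → (∀ a, η₀ ≤ a → g a = 0) →
    ∀ Ψ : V3 × V3 × V3 → ℝ, Continuous Ψ → (∃ C : ℝ, ∀ q, |Ψ q| ≤ C) →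
    (∀ (n v w : V3), ‖n‖ = 1 → Ψ (-n, (reflectVel n (v, w)).1, (reflectVel n (v, w)).2) = -Ψ (n, v, w)) →
    ∀ ϑ : ℝ, 0 < ϑ → ∀ y : ℝ, 0 < y →
    ∃ K₀ : ℕ, ∀ K : ℕ, K₀ ≤ K → ∃ N₀ : ℕ, ∀ N : ℕ, N₀ ≤ N →
    ∀ s ∈ Set.Icc (0 : ℝ) τ, ∀ ℓ : ℝ,
      (K : ℝ) * ((N + 1 : ℕ) : ℝ) ^ (-(1 / 3 : ℝ)) / 2 ≤ ℓ → ℓ ≤ (K : ℝ) * ((N + 1 : ℕ) : ℝ) ^ (-(1 / 3 : ℝ)) →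
      |∫ z, metroOddSum σ N (Φ N) (Set.Ioc 0 ℓ) (fun p => χ (p.1 + s, p.2)) g Ψ
          ((K : ℝ) ^ (1 / 4 : ℝ) * ((N + 1 : ℕ) : ℝ) ^ (-(1 / 3 : ℝ))) ϑ z
        ∂(localGibbsLaw σ (fun _ => 1) (fun _ => 0) (fun _ => θe) N (Φ N))|
      ≤ y * K * ((N : ℝ) + 1) := by
  intro hG1 hP4
  refine ⟨1, one_pos, fun θe hθe => ?_⟩
  obtain ⟨σP, hσP, hP4'⟩ := hP4 θe hθe
  clear hP4
  have hv₁ : 0 < v₁ := v₁_pos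
  refine ⟨min σP (min (1 / 4) (1 / (2 * v₁))), lt_min hσP (lt_min (by norm_num) (by positivity)), ?_⟩
  intro σ hσ hσlt Φ τ hτ χ hχ g hg hg0 Ψ hΨ hΨb hΨodd ϑ hϑ y hy
  obtain ⟨CΨ, hCΨ⟩ := hΨb
  have hσP' : σ < σP := hσlt.trans_le (min_le_left _ _)
  have hσ4 : σ < 1 / 4 := hσlt.trans_le ((min_le_right _ _).trans (min_le_left _ _))
  have hσv : σ < 1 / (2 * v₁) := hσlt.trans_le ((min_le_right _ _).trans (min_le_right _ _))
  have hσ2 : σ < 1 / 2 := hσ4.trans_le (by norm_num)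
  have hlam : v₁ * σ ^ 3 ≤ 1 / 2 := by
    have h1 : σ ^ 3 ≤ σ := pow_le_of_le_one hσ.le (by linarith) three_ne_zero
    have h2 : v₁ * σ ≤ 1 / 2 := by
      rw [lt_div_iff₀ (by positivity)] at hσv
      linarith
    exact (mul_le_mul_of_nonneg_left h1 hv₁.le).trans h2
  -- constants of the data `χ, g, Ψ, σ, θe`
  obtain ⟨Cχ, hCχ0, hCχ⟩ := exists_abs_bound_chi hχ (τ + 1)
  have hghc : Continuous fun a => g (max a 0) := hg.comp (continuous_id.max continuous_const)
  obtain ⟨Cg, hCg0, hCg⟩ : ∃ Cg : ℝ, 0 ≤ Cg ∧ ∀ a, |g (max a 0)| ≤ Cg := by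
    obtain ⟨C, hC0, hC⟩ := exists_abs_bound_of_cutoff hg hg0
    exact ⟨C, hC0, fun a => hC _ (le_max_right _ _)⟩
  have hCΨ0 : 0 ≤ CΨ := (abs_nonneg _).trans (hCΨ 0)
  obtain ⟨Ev, hEv, hEv_def⟩ : ∃ Ev : ℝ, 0 ≤ Ev ∧ Ev = ∫ v, ‖v‖ ∂gaussMeasure (0 : V3) θe :=
    ⟨_, integral_nonneg fun _ => norm_nonneg _, rfl⟩
  obtain ⟨M, hM, hM_def⟩ : ∃ M : ℝ, 0 ≤ M ∧ M = Cg * CΨ * (48 * v₁ * σ ^ 2 * Ev) := ⟨_, by positivity, rfl⟩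
  obtain ⟨y', hy', hy'_def⟩ : ∃ y' : ℝ, 0 < y' ∧ y' = y / (3 * (Cχ * M + 1)) := ⟨_, by positivity, rfl⟩
  obtain ⟨e, he, he_def⟩ : ∃ e : ℝ, 0 < e ∧ e = y / (3 * (M + 1)) := ⟨_, by positivity, rfl⟩
  obtain ⟨K₀, hK₀⟩ := hP4' σ hσ hσP' ϑ hϑ y' hy'
  clear hP4'
  refine ⟨max K₀ 1, fun K hK => ?_⟩
  have hK1 : 1 ≤ K := (le_max_right _ _).trans hK
  have hKpos : (0 : ℝ) < K := by exact_mod_cast hK1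
  obtain ⟨N₀, hN₀⟩ := hK₀ K ((le_max_left _ _).trans hK)
  clear hK₀
  obtain ⟨δ, hδ, hδ1, hmod_t, hmod_x⟩ := chi_moduli hχ τ he
  obtain ⟨N₁, hN₁⟩ := eventually_scale_le K (2 * σ) hδ
  refine ⟨max N₀ N₁, fun N hN s hs ℓ hℓlo hℓhi => ?_⟩
  have hP4N := hN₀ N ((le_max_left _ _).trans hN)
  clear hN₀
  obtain ⟨hKt, h2σt⟩ := hN₁ N ((le_max_right _ _).trans hN)
  -- scales
  have htN : 0 < ((N + 1 : ℕ) : ℝ) ^ (-(1 / 3 : ℝ)) := Real.rpow_pos_of_pos (by positivity) _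
  have hrK : 0 < (K : ℝ) ^ (1 / 4 : ℝ) * ((N + 1 : ℕ) : ℝ) ^ (-(1 / 3 : ℝ)) :=
    mul_pos (Real.rpow_pos_of_pos hKpos _) htN
  have hℓ0 : 0 < ℓ := lt_of_lt_of_le (by positivity) hℓlo
  have hℓδ : ℓ ≤ δ := hℓhi.trans hKt
  have hℓ1 : ℓ ≤ 1 := hℓδ.trans hδ1
  have h2ε : 2 * hsDiameter σ N ≤ δ := by
    change 2 * (σ * ((N + 1 : ℕ) : ℝ) ^ (-(1 / 3 : ℝ))) ≤ δ
    linarith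
  -- the shifted weight `χ₁ = χ(· + s, ·)` and the frozen weight `χ₀ = χ(s, ·)`
  have hχ₁c : Continuous fun p : ℝ × UnitAddTorus (Fin 3) => χ (p.1 + s, p.2) := by fun_prop
  have hχ₀c : Continuous fun x : UnitAddTorus (Fin 3) => χ (s, x) := by fun_prop
  have hsτ : s ∈ Icc (0 : ℝ) (τ + 1) := ⟨hs.1, by linarith [hs.2]⟩
  have hχ₀b : ∀ x, |χ (s, x)| ≤ Cχ := fun x => hCχ s hsτ x
  have hχ₁b : ∀ t ∈ Ioc (0 : ℝ) ℓ, ∀ x : UnitAddTorus (Fin 3), |χ (t + s, x)| ≤ Cχ := fun t ht x =>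
    hCχ (t + s) ⟨by linarith [hs.1, ht.1], by linarith [hs.2, ht.2]⟩ x
  have hω : ∀ t ∈ Ioc (0 : ℝ) ℓ, ∀ x : UnitAddTorus (Fin 3), |χ (t + s, x) - χ (s, x)| ≤ e := fun t ht x =>
    hmod_t s hs t ⟨ht.1.le, ht.2.trans hℓδ⟩ x
  have hϖ : ∀ x x' : UnitAddTorus (Fin 3), Torus.euclidDist x x' ≤ 2 * hsDiameter σ N →
      |χ (s, x) - χ (s, x')| ≤ e := fun x x' hxx' => hmod_x s hs x x' (hxx'.trans h2ε)
  -- G1 at `N` for the frozen weight, then the fixed-`N` core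
  have hG1N := hG1 hσ hσ4 hθe N (χ := fun p : ℝ × UnitAddTorus (Fin 3) => χ (s, p.2)) (g := fun a => g (max a 0))
    (r := (K : ℝ) ^ (1 / 4 : ℝ) * ((N + 1 : ℕ) : ℝ) ^ (-(1 / 3 : ℝ)))
    (hχ₀c.comp continuous_snd) hghc hΨ hrK hϑ (fun p => hχ₀b p.2) hCg hCΨ he.le hϖ hΨodd
  clear hG1
  have hcore := slab_mean_core hσ hσ2 hlam hθe N (Φ N) (χ₀ := fun x => χ (s, x)) hχ₁c hχ₀c hghc hΨ hrK hϑ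
    hℓ0.le he.le hy'.le hCχ0 hχ₁b hχ₀b hCg hCΨ hω hG1N hP4N
  rw [← hEv_def] at hcore
  -- replace `g` by `g ∘ (· ⊔ 0)` in the goal
  have hI : ∫ z, metroOddSum σ N (Φ N) (Set.Ioc 0 ℓ) (fun p => χ (p.1 + s, p.2)) g Ψ
        ((K : ℝ) ^ (1 / 4 : ℝ) * ((N + 1 : ℕ) : ℝ) ^ (-(1 / 3 : ℝ))) ϑ z
        ∂(localGibbsLaw σ (fun _ => 1) (fun _ => 0) (fun _ => θe) N (Φ N)) =
      ∫ z, metroOddSum σ N (Φ N) (Set.Ioc 0 ℓ) (fun p => χ (p.1 + s, p.2)) (fun a => g (max a 0)) Ψ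
        ((K : ℝ) ^ (1 / 4 : ℝ) * ((N + 1 : ℕ) : ℝ) ^ (-(1 / 3 : ℝ))) ϑ z
        ∂(localGibbsLaw σ (fun _ => 1) (fun _ => 0) (fun _ => θe) N (Φ N)) :=
    integral_congr_ae (Eventually.of_forall fun z => (metroOddSum_g_max hσ.le (Φ N) _ _ g Ψ hrK ϑ z).symm)
  rw [hI]
  refine hcore.trans ?_
  -- arithmetic: `(c/2 + e C_g C_Ψ) · 48 v₁ σ² E‖v‖ K (N+1) ≤ y K (N+1)`
  exact final_arith hy.le hM hCχ0 hCg0 hCΨ0 he.le hy'.le (by positivity) hM_def he_def hy'_def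
    (count_arith (σ := σ) hEv K N hℓhi)

end Summit.AtomisticToContinuum.HydrodynamicLimit.Theorems.OddContactSymmetryKineticSlab

end
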